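import Mathlib
import Literature.NumberTheory.Sieve.PolynomialCongruences
import Literature.NumberTheory.Sieve.QuadraticRootsAllModuliDomains
import HarnessLib

/-!
# Hooley 1963: the power saving for the roots of `ν² ≡ D (mod n)` to all moduli — PROVED, with `(log N)²`

Topic `Literature/NumberTheory/Sieve`.  Final file of the tree's proof of C. Hooley's theorem
(*On the number of divisors of quadratic polynomials*, Acta Math. 110 (1963), 97–114, THEOREM 1,
p. 110; method §6, pp. 105–110): for an integer `D` which is not a square and `h ≠ 0`,

  `∑_{n ≤ N} ∑_{ν mod n, ν² ≡ D (mod n)} e(hν/n) = O_{D,h}(N^{3/4} (log N)²)`.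

Hooley's Theorem 1 as printed (p. 110): "Let `D` be any fixed integer that is not a perfect square,
and let `R(h, x) = ∑_{k ≤ x} ∑_{ν² ≡ D (mod k), 0 < ν ≤ k} e^{2πihν/k}`.  Then, for `h ≠ 0`,
`R(h, x) = O{|h|^{4/5} σ²_{−1/2}(h) log² x} + O{σ²_{−1/2}(h) x^{3/4} log² x}`, and, in particular,
`|R(h, x)| ≤ A(h) x^{3/4} log² x`."  The named fact proved here is exactly the "in particular"
clause (`ν = k` and `ν = 0` contribute the same term `1`, so `0 < ν ≤ k` and `0 ≤ ν < k` agree).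

The chain: roots `↔` `T`-reduced forms of discriminant `4D` with `0 < A ≤ N`
(`RootForms.sum_weylSum_eq_sum_levelForms`, DFI 1995 (13)–(14)) `→` finitely many classes
(`RootForms.sum_levelFormsUpTo_eq_sum_classReps`) `→` for each class, primitive vectors in a
fundamental domain of a group of automorphs and Hooley's fraction formula
(`QuadraticRootsAllModuliVectors.lean`) `→` incomplete Kloosterman sums bounded through Weil's
bound (`QuadraticRootsAllModuliKloosterman.lean`, `weil_kloosterman_bound_holds`) `→` the class
bound `O(N^{3/4}(log N)²)` from slice data (`QuadraticRootsAllModuliDomains.lean`,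
`Hooley1963.SliceData.isBigO_sum_class`).  This file supplies the slice data for BOTH signs of the
discriminant and assembles the theorem:

* **Part I, definite classes** (`A > 0`, `Δ = B² − 4AC < 0`): the automorph group is finite; one
  takes `G' = {±1}` with the fundamental domain `halfPlane = {r > 0} ∪ {r = 0, p > 0}`, whose slices
  are read off from `4A·P(p, r) = (2Ap + Br)² + |Δ| r²`: for `r ≥ 1`,
  `P(p, r) ≤ N ⇔ |2Ap + Br| ≤ ⌊√(4AN − |Δ|r²)⌋` (`definite_slice`), an integer interval of length
  `≤ (2√A + 3)√N`, empty unless `r ≤ ⌊√(4AN)⌋`, on which `|h(2Ap + Br)/(2rP)| ≤ 2A|h|/r²`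
  (`definite_twist_le`, as `|2Ap + Br|·r ≤ (2Ap+Br)² + |Δ|r² = 4AP`); `definiteData : SliceData P h`.
  This is the bookkeeping of Hooley, Acta Math. 117 (1967), §6 (32)–(35) ("Since `u > 0` and `D`
  is negative, the forms will be positive … for given `r` the values of `s` range through all the
  integer values in one or two intervals").
* **Part II, indefinite classes** (`A > 0`, `Δ > 0` non-square) — the case Hooley leaves to the
  reader ("The proof will only be given for the case in which `D` is negative, since the proof in
  the other case is similar although rather harder", Acta Math. 117, p. 282; likewise in 1963).
  A positive solution `(x₁, y₁)` of Pell's equation `x² − Δy² = 1` (`Pell.exists_of_not_isSquare`)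
  gives the automorph `g = (x₁ − By₁, −2Cy₁; 2Ay₁, x₁ + By₁) ∈ stab P` (`pellAut`), which multiplies
  the linear factors `ℓ± = 2Ap + (B ± √Δ)r` of `4A·P = ℓ₊ℓ₋` by `η^{±1}`, `η = x₁ + y₁√Δ > 1`
  (`ell_vecAct_zpow`); hence the sector `F = {0 < ℓ₋ ≤ ℓ₊ < η² ℓ₋}` is a fundamental domain for
  `G' = {±g^k}` on `{P > 0}` (`sector_fund`: bring `w` into `{ℓ₋ > 0}` by `±1`, then the ratio
  `ℓ₊/ℓ₋` into `[1, η²)` by the unique power `g^{−⌊log(ℓ₊/ℓ₋)/(2 log η)⌋}`).  Its slices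
  (`indefinite_slice`): for `r ≥ 1`, `(p, r) ∈ F ⇔ 2Ap + Br > γr`, `γ = √Δ(η² + 1)/(η² − 1)`, and
  then `P(p, r) ≤ N ⇔ 2Ap + Br ≤ ⌊√(4AN + Δr²)⌋`, an integer interval of length `≪ √N`, empty unless
  `r ≤ ⌈κ√N⌉`, `κ = √(4A/(γ² − Δ))`, on which `|h(2Ap + Br)/(2rP)| ≤ Aη²|h|/r²`
  (`indefinite_twist_le`); `indefiniteData : SliceData P h`.  With Part I:
  `Hooley1963.isBigO_sum_class` — the class bound for every form with `A > 0` and non-square `Δ`.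
* **Part III, the theorem**: `hooley1963_quadraticRoots_allModuli_logSqSaving_holds` (below), via
  `sum_polyRootWeylSum_sq_sub_eq` (roots of `X² − D` as level forms with `a = 1, b = 0, c = −D`,
  `d = 1`), the class decomposition, and Part II class by class (`isBigO_sum_classFibre`).

## On the exponent of the logarithm (why the fact next door is not discharged as stated)

The named fact originally vendored as `hooley1963_quadraticRoots_allModuli_powerSaving`
(in `QuadraticRootsAllModuliPowerSaving.lean`, the record of the misquotation, which this file no
longer imports — verdict clean-up 2026-08-15: the old name survives at most as a deprecated alias
of the corrected fact below) rendered the one-line quotation of Dartyge–Martin, Discrete Analysis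
2019:15, §1 p. 3:
"Hooley [H63] obtained … `S(f, x, h) ≪_{f,h} x^{3/4} log x`", with a SINGLE logarithm.  The
original prints the SQUARE of the logarithm: Hooley's Theorem 1 (Acta Math. 110, p. 110, quoted
above; read 2026-08-15 from the Project Euclid Acta Mathematica archive) states
`|R(h, x)| ≤ A(h) x^{3/4} log² x`, and so do Duke, Friedlander and Iwaniec when quoting it
("`∑_{n ≤ x} ρ_h(n) ≪ x^{3/4} (log x)²`", Ann. of Math. 141 (1995), p. 424, (5)).  `(log x)²` is
what the method gives: one logarithm from completing the incomplete Kloosterman sums (Hooley's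
Lemma 3, p. 107: `O[|r|^{1/2} {(h, r)}^{1/2} d(r) log 2|r|]`), one from the divisor sum
`∑_{l ≤ y} d(l){(h, l)}^{1/2} = O{y log 2y σ_{−1/2}(h)}` (Lemma 4, p. 107), combined in (37)–(39),
p. 109 — neither is removable by the elementary means of the paper.  The single-logarithm form is
therefore a MISQUOTATION (no proof of it is in print); we vendor the printed form as the corrected
named fact `hooley1963_quadraticRoots_allModuli_logSqSaving` and PROVE it
(`hooley1963_quadraticRoots_allModuli_logSqSaving_holds`); the single-log statement (which
trivially implies this one, `N^{3/4} log N = O(N^{3/4}(log N)²)`, and is implied by nothing in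
print) is not a fact of the tree, and the corrected fact still implies the qualitative `o(N)`
(`hooley1963_quadraticRoots_allModuli_logSqSaving.isLittleO`), which is all the grounding uses
recorded in `QuadraticRootsAllModuliPowerSaving.lean` require (a power saving).  This file imports
`Mathlib` and `PolynomialCongruences` directly (formerly through
`QuadraticRootsAllModuliPowerSaving.lean`, of which nothing was used here).

Everything in this file is proved; the only new named fact is the corrected one, discharged here
(net debt `0`, D-0026).

## References

* C. Hooley, Acta Math. 110 (1963), 97–114: Theorem 1 p. 110 (the statement), §6 pp. 105–110
  (the method: (27)–(29) the fraction `ν/k`, Lemma 3 and Lemma 4 p. 107, (37)–(39) p. 109, the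
  indefinite case p. 109–110), §9 p. 113 (Theorem 3, uniform distribution of `ν/k`, deduced from
  Theorem 1).  Read from the Project Euclid Acta Mathematica archive (doi 10.1007/BF02391856).
  [cite: Hooley1963, Theorem 1 (p. 110)]
* C. Hooley, Acta Math. 117 (1967), 281–299, p. 282 and §6 (27)–(36) (the method written out for
  `D < 0`; read: `paper:galaxy-pdf-699250920`, pp. 2, 8–11). [cite: Hooley1967, §6 (27)–(36)]
* W. Duke, J. B. Friedlander, H. Iwaniec, Ann. of Math. (2) 141 (1995), p. 424, (5) (the printed
  bound `x^{3/4}(log x)²`, read: `paper:url-c7638613861e`, p. 3) and §2 (13)–(14).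
  [cite: DukeFriedlanderIwaniec1995, p. 424 (5)]
* C. Dartyge, G. Martin, Discrete Analysis 2019:15, §1 p. 3 (the single-log quotation).
  [cite: DartygeMartin2019, §1 p. 3]
* D. A. Cox, *Primes of the form x² + ny²*, 2nd ed. (2013), §2.A (the action of `SL₂(ℤ)` on
  forms; the automorph attached to a Pell unit is checked here by direct computation).
  [cite: Cox2013, §2.A]
-/

/-! ## Part I — definite classes: the half-plane domain and its slices -/

noncomputable section

namespace Literature.NumberTheory.Sieve

open scoped BigOperators MatrixGroups
open Finset Filter Asymptotics
open Literature.NumberTheory.QuadraticFields.Quadratic (BinQF)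

namespace Hooley1963

open RootForms

/-! ### Elementary lemmas -/

/-- `u² ≤ M ⇔ −⌊√M⌋ ≤ u ≤ ⌊√M⌋` for integers `u` and `M ≥ 0`. [folklore] -/
theorem sq_le_iff_abs_le_sqrt {u M : ℤ} (hM : 0 ≤ M) :
    u ^ 2 ≤ M ↔ -((Nat.sqrt M.toNat : ℕ) : ℤ) ≤ u ∧ u ≤ ((Nat.sqrt M.toNat : ℕ) : ℤ) := by
  rw [← abs_le, ← Int.natCast_natAbs, Nat.cast_le, Nat.le_sqrt']
  constructor
  · intro h
    have h2 : ((u.natAbs ^ 2 : ℕ) : ℤ) ≤ M := by push_cast; rw [sq_abs]; exact h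
    exact (Int.le_toNat hM).2 h2
  · intro h
    have h2 := (Int.le_toNat hM).1 h
    push_cast at h2
    rwa [sq_abs] at h2

/-- `Y ≤ c·p ⇔ (Y − 1)/c < p` (`c > 0`, floor division). [folklore] -/
theorem le_mul_iff_ediv_lt {c : ℤ} (hc : 0 < c) (Y p : ℤ) : Y ≤ c * p ↔ (Y - 1) / c < p := by
  rw [Int.ediv_lt_iff_lt_mul hc]
  constructor <;> intro h <;> nlinarith

/-- `c·p ≤ X ⇔ p < X/c + 1` (`c > 0`, floor division). [folklore] -/
theorem mul_le_iff_lt_ediv_add_one {c : ℤ} (hc : 0 < c) (X p : ℤ) : c * p ≤ X ↔ p < X / c + 1 := by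
  rw [Int.lt_add_one_iff, Int.le_ediv_iff_mul_le hc, mul_comm]

/-! ### The half-plane domain -/

/-- The fundamental domain for `{±1}`: `{r > 0} ∪ {r = 0, p > 0}`. [cite: Hooley1967, §6 (30)] -/
def halfPlane : Set (ℤ × ℤ) := {v | 0 < v.2 ∨ (v.2 = 0 ∧ 0 < v.1)}

/-- Membership in `halfPlane`. [folklore] -/
theorem mem_halfPlane (v : ℤ × ℤ) : v ∈ halfPlane ↔ 0 < v.2 ∨ (v.2 = 0 ∧ 0 < v.1) := Iff.rfl

/-- The elements of `{±1} = signedZpowers 1`. [folklore] -/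
theorem mem_signedZpowers_one {s : SL(2, ℤ)} : s ∈ signedZpowers 1 ↔ s = 1 ∨ s = -1 := by
  rw [mem_signedZpowers]
  simp only [one_zpow]
  exact ⟨fun ⟨_, h⟩ => h, fun h => ⟨0, h⟩⟩

/-- **`halfPlane` is a fundamental domain for `{±1}` on `ℤ² ∖ {0}`** (so on `{P > 0}`).
[folklore] -/
theorem halfPlane_fund (P : BinQF) (w : ℤ × ℤ) (hw : 0 < P.eval w.1 w.2) :
    ∃! v, v ∈ halfPlane ∧ ∃ s ∈ signedZpowers 1, v = vecAct s w := by
  have hw0 : w ≠ 0 := by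
    rintro rfl
    simp [BinQF.eval] at hw
  have hw0' : w.1 ≠ 0 ∨ w.2 ≠ 0 := by
    by_contra hcon
    push Not at hcon
    exact hw0 (Prod.ext hcon.1 hcon.2)
  by_cases hc : 0 < w.2 ∨ (w.2 = 0 ∧ 0 < w.1)
  · refine ⟨w, ⟨hc, 1, (signedZpowers 1).one_mem, (vecAct_one w).symm⟩, ?_⟩
    rintro v ⟨hv, s, hs, rfl⟩
    rcases mem_signedZpowers_one.1 hs with rfl | rfl
    · exact vecAct_one w
    · rw [vecAct_neg, vecAct_one, mem_halfPlane] at hv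
      simp only [Prod.snd_neg, Prod.fst_neg] at hv
      omega
  · refine ⟨-w, ⟨?_, -1, mem_signedZpowers_one.2 (Or.inr rfl), by rw [vecAct_neg, vecAct_one]⟩, ?_⟩
    · rw [mem_halfPlane]
      simp only [Prod.snd_neg, Prod.fst_neg]
      omega
    · rintro v ⟨hv, s, hs, rfl⟩
      rcases mem_signedZpowers_one.1 hs with rfl | rfl
      · rw [vecAct_one, mem_halfPlane] at hv
        exact absurd hv hc
      · rw [vecAct_neg, vecAct_one]

/-! ### The slices of a positive definite form -/

section definite

variable (P : BinQF) (h : ℤ)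

/-- `⌊√(4AN − |Δ|r²)⌋` (and `0` past the last slice). [folklore] -/
def dsqrt (N r : ℕ) : ℤ := ((Nat.sqrt (4 * P.a * N + P.disc * (r : ℤ) ^ 2).toNat : ℕ) : ℤ)

/-- Left end of the slice: `a < p ⇔ −⌊√M⌋ − Br ≤ 2Ap`. [folklore] -/
def dLeft (N r : ℕ) : ℤ :=
  if 0 ≤ 4 * P.a * N + P.disc * (r : ℤ) ^ 2 then (-dsqrt P N r - P.b * r - 1) / (2 * P.a) else 0

/-- Right end of the slice: `p < b ⇔ 2Ap ≤ ⌊√M⌋ − Br`. [folklore] -/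
def dRight (N r : ℕ) : ℤ :=
  if 0 ≤ 4 * P.a * N + P.disc * (r : ℤ) ^ 2 then (dsqrt P N r - P.b * r) / (2 * P.a) + 1 else 0

variable {P}

/-- **The slices of the half-plane domain**: for `A > 0`, `Δ < 0`, `N, r ≥ 1` and any `p`,
`(p, r) ∈ F ∧ 0 < P(p,r) ≤ N ⇔ r ≤ ⌊√(4AN)⌋ ∧ dLeft < p < dRight`.
[cite: Hooley1967, §6 (32)–(33)] -/
theorem definite_slice (hA : 0 < P.a) (hΔ : P.disc < 0) (N : ℕ) (r : ℕ) (hr : 1 ≤ r) (p : ℤ) :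
    ((p, (r : ℤ)) ∈ halfPlane ∧ 0 < P.eval p r ∧ P.eval p r ≤ N) ↔
      (r ≤ Nat.sqrt (4 * P.a.toNat * N) ∧ dLeft P N r < p ∧ p < dRight P N r) := by
  have hF : (p, (r : ℤ)) ∈ halfPlane := Or.inl (by simp; omega)
  have hid := P.four_mul_a_mul_eval p r
  set u : ℤ := 2 * P.a * p + P.b * r with hu
  set M : ℤ := 4 * P.a * N + P.disc * (r : ℤ) ^ 2 with hMdef
  have hr1 : (1 : ℤ) ≤ r := by exact_mod_cast hr
  have hr2 : (1 : ℤ) ≤ (r : ℤ) ^ 2 := by nlinarith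
  have hpos : 0 < P.eval p r := by
    have : 0 < 4 * P.a * P.eval p r := by rw [hid]; nlinarith [sq_nonneg u]
    exact pos_of_mul_pos_right this (by linarith)
  have hAcast : ((P.a.toNat : ℕ) : ℤ) = P.a := Int.toNat_of_nonneg hA.le
  -- `P ≤ N ⇔ u² ≤ M`
  have hPN : P.eval p r ≤ N ↔ u ^ 2 ≤ M := by
    constructor
    · intro h; rw [hMdef]; nlinarith
    · intro h; rw [hMdef] at h; nlinarith
  simp only [hF, hpos, true_and]
  rw [hPN]
  by_cases hM : 0 ≤ M
  · have hL : dLeft P N r = (-dsqrt P N r - P.b * r - 1) / (2 * P.a) := by rw [dLeft, if_pos hM]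
    have hR : dRight P N r = (dsqrt P N r - P.b * r) / (2 * P.a) + 1 := by rw [dRight, if_pos hM]
    rw [hL, hR, ← le_mul_iff_ediv_lt (by linarith), ← mul_le_iff_lt_ediv_add_one (by linarith),
      sq_le_iff_abs_le_sqrt hM, dsqrt, ← hMdef]
    constructor
    · rintro ⟨h1, h2⟩
      refine ⟨?_, by rw [hu] at h1; linarith, by rw [hu] at h2; linarith⟩
      -- `r ≤ ⌊√(4AN)⌋` since `|Δ| r² ≤ 4AN`
      rw [Nat.le_sqrt']
      have h3 : (r : ℤ) ^ 2 ≤ 4 * P.a * N := by rw [hMdef] at hM; nlinarith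
      have h4 : ((r ^ 2 : ℕ) : ℤ) ≤ ((4 * P.a.toNat * N : ℕ) : ℤ) := by push_cast; rw [hAcast]; exact h3
      exact_mod_cast h4
    · rintro ⟨-, h1, h2⟩
      exact ⟨by rw [hu]; linarith, by rw [hu]; linarith⟩
  · have hL : dLeft P N r = 0 := by rw [dLeft, if_neg hM]
    have hR : dRight P N r = 0 := by rw [dRight, if_neg hM]
    rw [hL, hR]
    constructor
    · intro h; exact absurd ((sq_nonneg u).trans h) hM
    · rintro ⟨-, h1, h2⟩; omega

/-- Length of the slices: `dLeft ≤ dRight` and `dRight − dLeft ≤ (2√A + 3)√N` (`N ≥ 1`).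
[folklore] -/
theorem definite_ab_le (hA : 0 < P.a) (hΔ : P.disc < 0) {N : ℕ} (hN : 1 ≤ N) (r : ℕ) :
    dLeft P N r ≤ dRight P N r ∧
      ((dRight P N r - dLeft P N r : ℤ) : ℝ) ≤ (2 * Real.sqrt P.a + 3) * Real.sqrt N := by
  have hA' : (0 : ℝ) < P.a := by exact_mod_cast hA
  have hN' : (1 : ℝ) ≤ N := by exact_mod_cast hN
  have hsN : 1 ≤ Real.sqrt N := by rw [← Real.sqrt_one]; exact Real.sqrt_le_sqrt hN'
  have hsA : 1 ≤ Real.sqrt P.a := by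
    rw [← Real.sqrt_one]; exact Real.sqrt_le_sqrt (by exact_mod_cast hA)
  set M : ℤ := 4 * P.a * N + P.disc * (r : ℤ) ^ 2 with hMdef
  by_cases hM : 0 ≤ M
  · have hL : dLeft P N r = (-dsqrt P N r - P.b * r - 1) / (2 * P.a) := by rw [dLeft, if_pos hM]
    have hR : dRight P N r = (dsqrt P N r - P.b * r) / (2 * P.a) + 1 := by rw [dRight, if_pos hM]
    set s := dsqrt P N r with hsdef
    have hs0 : 0 ≤ s := by rw [hsdef, dsqrt]; positivity
    have hc : (0 : ℤ) < 2 * P.a := by linarith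
    -- `s ≤ 2√A √N`
    have hsle : (s : ℝ) ≤ 2 * Real.sqrt P.a * Real.sqrt N := by
      have h1 : (s : ℝ) ≤ Real.sqrt ((M.toNat : ℕ) : ℝ) := by
        rw [hsdef, dsqrt, ← hMdef]; push_cast; exact Real.nat_sqrt_le_real_sqrt
      have h2 : ((M.toNat : ℕ) : ℝ) ≤ 4 * P.a * N := by
        have h3 : (M.toNat : ℤ) = M := Int.toNat_of_nonneg hM
        have h4 : M ≤ 4 * P.a * N := by
          rw [hMdef]; nlinarith [sq_nonneg (r : ℤ)]
        have : ((M.toNat : ℤ) : ℝ) ≤ ((4 * P.a * N : ℤ) : ℝ) := by exact_mod_cast h3.le.trans h4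
        push_cast at this; exact this
      calc (s : ℝ) ≤ Real.sqrt ((M.toNat : ℕ) : ℝ) := h1
        _ ≤ Real.sqrt (4 * P.a * N) := Real.sqrt_le_sqrt h2
        _ = 2 * Real.sqrt P.a * Real.sqrt N := by
            rw [show (4 : ℝ) * P.a * N = 2 ^ 2 * (P.a * N) by ring, Real.sqrt_mul (by norm_num),
              Real.sqrt_sq (by norm_num), Real.sqrt_mul hA'.le]; ring
    -- floor-division bounds
    have hX : (((s - P.b * r) / (2 * P.a) : ℤ) : ℝ) ≤ ((s - P.b * r : ℤ) : ℝ) / ((2 * P.a : ℤ) : ℝ) := by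
      rw [le_div_iff₀ (by exact_mod_cast hc)]
      exact_mod_cast Int.ediv_mul_le _ hc.ne'
    have hY : ((-s - P.b * r - 1 : ℤ) : ℝ) / ((2 * P.a : ℤ) : ℝ) - 1 ≤
        (((-s - P.b * r - 1) / (2 * P.a) : ℤ) : ℝ) := by
      rw [sub_le_iff_le_add, div_le_iff₀ (by exact_mod_cast hc)]
      exact_mod_cast (Int.lt_ediv_add_one_mul_self (-s - P.b * r - 1) hc).le
    constructor
    · rw [hL, hR]
      have : (-s - P.b * r - 1) / (2 * P.a) ≤ (s - P.b * r) / (2 * P.a) :=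
        Int.ediv_le_ediv hc (by linarith)
      linarith
    · rw [hL, hR]
      push_cast
      have hA1 : (1 : ℝ) ≤ P.a := by exact_mod_cast (show (1 : ℤ) ≤ P.a by omega)
      have hs0' : (0 : ℝ) ≤ s := by exact_mod_cast hs0
      have hfrac : ((s - P.b * r : ℤ) : ℝ) / ((2 * P.a : ℤ) : ℝ) -
          ((-s - P.b * r - 1 : ℤ) : ℝ) / ((2 * P.a : ℤ) : ℝ) ≤ s + 1 := by
        rw [← sub_div, div_le_iff₀ (by push_cast; linarith)]
        push_cast
        nlinarith
      push_cast at hX hY hfrac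
      nlinarith
  · have hL : dLeft P N r = 0 := by rw [dLeft, if_neg hM]
    have hR : dRight P N r = 0 := by rw [dRight, if_neg hM]
    rw [hL, hR]
    refine ⟨le_rfl, ?_⟩
    simp only [sub_self, Int.cast_zero]
    positivity

/-- **The twist on a slice**: for `A > 0`, `Δ < 0`, `r ≥ 1` and any `p`,
`|e(−h(2Ap + Br)/(2rP(p,r))) − 1| ≤ 4πA|h|/r²`, since `|2Ap + Br|·r ≤ (2Ap + Br)² + |Δ|r² = 4AP`.
[cite: Hooley1967, §6 (34)] -/
theorem definite_twist_le (hA : 0 < P.a) (hΔ : P.disc < 0) (h : ℤ) {r : ℕ} (hr : 1 ≤ r) (p : ℤ) :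
    ‖twist P h r p - 1‖ ≤ (4 * Real.pi * P.a * |(h : ℝ)|) / (r : ℝ) ^ 2 := by
  have hid := P.four_mul_a_mul_eval p r
  set u : ℤ := 2 * P.a * p + P.b * r with hu
  have hr1 : (1 : ℤ) ≤ r := by exact_mod_cast hr
  have hPpos : 0 < P.eval p r := by
    have : 0 < 4 * P.a * P.eval p r := by rw [hid]; nlinarith [sq_nonneg u]
    exact pos_of_mul_pos_right this (by linarith)
  -- `|u| r ≤ 4 A P`
  have hkey : |u| * r ≤ 4 * P.a * P.eval p r := by
    rw [hid]
    have h1 : |u| * (r : ℤ) ≤ u ^ 2 + (r : ℤ) ^ 2 := by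
      rcases abs_choice u with h | h <;> rw [h] <;> nlinarith [sq_nonneg (u - r), sq_nonneg (u + r)]
    nlinarith
  rw [twist_eq_fourierChar]
  -- `|e(x) − 1| ≤ 2π|x|` (cf. the tree's `CircleMethodKernel.norm_fourierChar_sub_one_le`)
  have hlip : ∀ x : ℝ, ‖(Real.fourierChar x : ℂ) - 1‖ ≤ 2 * Real.pi * |x| := fun x => by
    rw [Vinogradov.norm_fourierChar_sub_one]
    have := Real.abs_sin_le_abs (x := Real.pi * x)
    rw [abs_mul, abs_of_pos Real.pi_pos] at this
    linarith
  refine (hlip _).trans ?_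
  have hr' : (0 : ℝ) < r := by exact_mod_cast hr
  have hP' : (0 : ℝ) < (P.eval p r : ℝ) := by exact_mod_cast hPpos
  have hkey' : |(u : ℝ)| * r ≤ 4 * P.a * (P.eval p r : ℝ) := by
    have : ((|u| * r : ℤ) : ℝ) ≤ ((4 * P.a * P.eval p r : ℤ) : ℝ) := by exact_mod_cast hkey
    push_cast at this; exact this
  have hucast : ((2 * P.a * p + P.b * r : ℤ) : ℝ) = (u : ℝ) := by rw [hu]
  rw [hucast, abs_neg, abs_div, abs_mul,
    show |(2 : ℝ) * (r : ℝ) * (P.eval p r : ℝ)| = 2 * r * (P.eval p r : ℝ) by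
      rw [abs_of_pos (by positivity)],
    show 2 * Real.pi * (|(h : ℝ)| * |(u : ℝ)| / (2 * r * (P.eval p r : ℝ))) =
      (2 * Real.pi * |(h : ℝ)| * |(u : ℝ)|) / (2 * r * (P.eval p r : ℝ)) by ring,
    div_le_div_iff₀ (by positivity) (by positivity)]
  have hh0 : 0 ≤ |(h : ℝ)| := abs_nonneg _
  have hpi : 0 < Real.pi := Real.pi_pos
  have h1 := mul_le_mul_of_nonneg_left hkey' (by positivity : 0 ≤ 2 * Real.pi * |(h : ℝ)| * r)
  nlinarith [h1]

/-- **Slice data for a positive definite class** (`A > 0`, `Δ < 0`): `G' = {±1}`, the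
half-plane domain, `R_N = ⌊√(4AN)⌋`, the slices of `definite_slice`, and the constants
`c₁ = 2√A`, `c₂ = 2√A + 3`, `c₃ = 4πA|h|`. [cite: Hooley1967, §6 (30)–(35)] -/
def definiteData (P : BinQF) (h : ℤ) (hA : 0 < P.a) (hΔ : P.disc < 0) : SliceData P h where
  F := halfPlane
  G' := signedZpowers 1
  R := fun N => Nat.sqrt (4 * P.a.toNat * N)
  a := fun N r => dLeft P N r
  b := fun N r => dRight P N r
  c₁ := 2 * Real.sqrt P.a
  c₂ := 2 * Real.sqrt P.a + 3
  c₃ := 4 * Real.pi * P.a * |(h : ℝ)|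
  hc₁ := by positivity
  hc₂ := by positivity
  hc₃ := mul_nonneg (mul_nonneg (by positivity) (by exact_mod_cast hA.le)) (abs_nonneg _)
  le_stab := signedZpowers_le_stab (stab P).one_mem
  fund := halfPlane_fund P
  snd_nonneg := fun v hv => by rcases hv with hv | ⟨hv, -⟩ <;> omega
  fst_axis := fun p => by rw [mem_halfPlane]; simp
  slice := fun N _ r hr p => definite_slice hA hΔ N r hr p
  R_le := fun N hN => by
    have hAcast : ((P.a.toNat : ℕ) : ℝ) = (P.a : ℝ) := by
      have : ((P.a.toNat : ℕ) : ℤ) = P.a := Int.toNat_of_nonneg hA.le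
      exact_mod_cast this
    calc ((Nat.sqrt (4 * P.a.toNat * N) : ℕ) : ℝ) ≤ Real.sqrt ((4 * P.a.toNat * N : ℕ) : ℝ) :=
          Real.nat_sqrt_le_real_sqrt
      _ = 2 * Real.sqrt P.a * Real.sqrt N := by
          push_cast
          rw [hAcast, show (4 : ℝ) * P.a * N = 2 ^ 2 * (P.a * N) by ring, Real.sqrt_mul (by norm_num),
            Real.sqrt_sq (by norm_num), Real.sqrt_mul (by exact_mod_cast hA.le)]
          ring
  ab_le := fun N hN r _ => definite_ab_le hA hΔ hN r
  twist_le := fun N _ r hr p _ => definite_twist_le hA hΔ h (Finset.mem_Icc.1 hr).1 p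

/-- **Hooley's bound for a positive definite class**: for `P` with `A > 0`, `Δ < 0` (non-square)
and `h ≠ 0`, `∑_{Q T-reduced ∼ P, 0 < A_Q ≤ N} e(h B_Q/(2A_Q)) = O(N^{3/4} (log N)²)`.
[cite: Hooley1963, §6] -/
theorem isBigO_sum_class_of_disc_neg {P : BinQF} (hA : 0 < P.a) (hΔ : P.disc < 0) {h : ℤ}
    (hh : h ≠ 0) (S : ℕ → Finset BinQF)
    (hS : ∀ N Q, Q ∈ S N ↔ (∃ ξ : SL(2, ℤ), Q = smul P ξ) ∧ IsTReduced Q ∧ 0 < Q.a ∧ Q.a ≤ N) :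
    (fun N : ℕ => ∑ Q ∈ S N, classWeight h Q) =O[atTop]
      fun N : ℕ => (N : ℝ) ^ (3 / 4 : ℝ) * Real.log N ^ 2 := by
  have hΔ' : ¬ IsSquare P.disc := fun ⟨k, hk⟩ => by nlinarith [sq_nonneg k]
  exact (definiteData P h hA hΔ).isBigO_sum_class hA hΔ' hh S hS

end definite

end Hooley1963

end Literature.NumberTheory.Sieve

end

/-! ## Part II — indefinite classes: the Pell sector and its slices -/

noncomputable section

namespace Literature.NumberTheory.Sieve

open scoped BigOperators MatrixGroups
open Finset Filter Asymptotics
open Literature.NumberTheory.QuadraticFields.Quadratic (BinQF)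

namespace Hooley1963

open RootForms

/-! ### Positive Pell units and the automorph they define -/

/-- A solution of Pell's equation `x² − Δy² = 1` with `x, y > 0`. [folklore] -/
structure PosPell (Δ : ℤ) where
  /-- the `x`-coordinate -/
  x : ℤ
  /-- the `y`-coordinate -/
  y : ℤ
  rel : x ^ 2 - Δ * y ^ 2 = 1
  x_pos : 0 < x
  y_pos : 0 < y

/-- For a positive non-square `Δ` there is a positive Pell unit (Lagrange; Mathlib's
`Pell.exists_of_not_isSquare`). [folklore] -/
theorem nonempty_posPell {Δ : ℤ} (h0 : 0 < Δ) (hΔ : ¬ IsSquare Δ) : Nonempty (PosPell Δ) := by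
  obtain ⟨x, y, hrel, hy⟩ := Pell.exists_of_not_isSquare h0 hΔ
  refine ⟨⟨|x|, |y|, by rw [sq_abs, sq_abs]; exact hrel, ?_, abs_pos.2 hy⟩⟩
  rw [abs_pos]
  rintro rfl
  have : Δ * y ^ 2 > 0 := by positivity
  nlinarith

variable (P : BinQF)

/-- **The automorph attached to a Pell unit**: `g = (x − By, −2Cy; 2Ay, x + By)` for
`x² − Δy² = 1`, `Δ = B² − 4AC` (determinant `x² − (B² − 4AC)y² = 1`). [cite: Cox2013, §2.A] -/
def pellAut (e : PosPell P.disc) : SL(2, ℤ) :=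
  ⟨!![e.x - P.b * e.y, -2 * P.c * e.y; 2 * P.a * e.y, e.x + P.b * e.y], by
    rw [Matrix.det_fin_two_of]
    have h : e.x ^ 2 - (P.b ^ 2 - 4 * P.a * P.c) * e.y ^ 2 = 1 := e.rel
    linear_combination h⟩

/-- Entries of `pellAut`. [folklore] -/
theorem pellAut_apply (e : PosPell P.disc) :
    pellAut P e 0 0 = e.x - P.b * e.y ∧ pellAut P e 0 1 = -2 * P.c * e.y ∧
      pellAut P e 1 0 = 2 * P.a * e.y ∧ pellAut P e 1 1 = e.x + P.b * e.y :=
  ⟨rfl, rfl, rfl, rfl⟩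

/-- **`g` is an automorph of `P`.** [cite: Cox2013, §2.A] -/
theorem pellAut_mem_stab (e : PosPell P.disc) : pellAut P e ∈ stab P := by
  have h : e.x ^ 2 - (P.b ^ 2 - 4 * P.a * P.c) * e.y ^ 2 = 1 := e.rel
  obtain ⟨h00, h01, h10, h11⟩ := pellAut_apply P e
  rw [mem_stab_iff, smul, h00, h01, h10, h11, BinQF.act]
  ext
  · simp only; linear_combination P.a * h
  · simp only; linear_combination P.b * h
  · simp only; linear_combination P.c * h

/-- The column action of `g`. [folklore] -/
theorem vecAct_pellAut (e : PosPell P.disc) (v : ℤ × ℤ) :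
    vecAct (pellAut P e) v =
      ((e.x - P.b * e.y) * v.1 + (-2 * P.c * e.y) * v.2, (2 * P.a * e.y) * v.1 + (e.x + P.b * e.y) * v.2) :=
  rfl

/-! ### The linear factors `ℓ± = 2Ap + (B ± √Δ) r` -/

/-- `√Δ`. [folklore] -/
def rt : ℝ := Real.sqrt P.disc

/-- `η = x₁ + y₁√Δ`, the eigenvalue of the automorph on `ℓ₊`. [folklore] -/
def eta (e : PosPell P.disc) : ℝ := e.x + e.y * rt P

/-- `ℓ₊(v) = 2A v₁ + (B + √Δ) v₂`. [folklore] -/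
def ellP (v : ℤ × ℤ) : ℝ := 2 * P.a * v.1 + (P.b + rt P) * v.2

/-- `ℓ₋(v) = 2A v₁ + (B − √Δ) v₂`. [folklore] -/
def ellM (v : ℤ × ℤ) : ℝ := 2 * P.a * v.1 + (P.b - rt P) * v.2

variable {P}

/-- `(√Δ)² = Δ` for `Δ ≥ 0`. [folklore] -/
theorem rt_sq (hΔ : 0 < P.disc) : rt P ^ 2 = P.disc :=
  Real.sq_sqrt (by exact_mod_cast hΔ.le)

/-- `√Δ ≥ 1` for `Δ ≥ 1`. [folklore] -/
theorem one_le_rt (hΔ : 0 < P.disc) : 1 ≤ rt P := by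
  rw [rt, ← Real.sqrt_one]
  exact Real.sqrt_le_sqrt (by exact_mod_cast hΔ)

/-- `√Δ > 0`. [folklore] -/
theorem rt_pos (hΔ : 0 < P.disc) : 0 < rt P := lt_of_lt_of_le one_pos (one_le_rt hΔ)

/-- `η (x₁ − y₁√Δ) = 1`. [folklore] -/
theorem eta_mul_conj (hΔ : 0 < P.disc) (e : PosPell P.disc) : eta P e * (e.x - e.y * rt P) = 1 := by
  have h := e.rel
  have hr := rt_sq hΔ
  have : ((e.x ^ 2 - P.disc * e.y ^ 2 : ℤ) : ℝ) = 1 := by exact_mod_cast h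
  push_cast at this
  rw [eta]
  linear_combination this - (e.y : ℝ) ^ 2 * hr

/-- `η > 1`. [folklore] -/
theorem one_lt_eta (hΔ : 0 < P.disc) (e : PosPell P.disc) : 1 < eta P e := by
  rw [eta]
  have hx : (1 : ℝ) ≤ e.x := by exact_mod_cast e.x_pos
  have hy : (1 : ℝ) ≤ e.y := by exact_mod_cast e.y_pos
  nlinarith [rt_pos hΔ]

/-- `η > 0`. [folklore] -/
theorem eta_pos (hΔ : 0 < P.disc) (e : PosPell P.disc) : 0 < eta P e := lt_trans one_pos (one_lt_eta hΔ e)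

/-- `x₁ − y₁√Δ = η⁻¹`. [folklore] -/
theorem conj_eq_eta_inv (hΔ : 0 < P.disc) (e : PosPell P.disc) : (e.x - e.y * rt P) = (eta P e)⁻¹ := by
  have h := eta_mul_conj hΔ e
  have hη := (eta_pos hΔ e).ne'
  field_simp
  linarith

/-- **`ℓ₊ ℓ₋ = 4A·P`**. [folklore] -/
theorem ellP_mul_ellM (hΔ : 0 < P.disc) (v : ℤ × ℤ) :
    ellP P v * ellM P v = 4 * P.a * (P.eval v.1 v.2 : ℝ) := by
  have hr := rt_sq hΔ
  have hid : ((4 * P.a * P.eval v.1 v.2 : ℤ) : ℝ) = ((2 * P.a * v.1 + P.b * v.2) ^ 2 - P.disc * v.2 ^ 2 : ℤ) := by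
    rw [BinQF.four_mul_a_mul_eval]
  push_cast at hid
  rw [ellP, ellM]
  linear_combination -hid - (v.2 : ℝ) ^ 2 * hr

/-- `ℓ₊ − ℓ₋ = 2√Δ·r`. [folklore] -/
theorem ellP_sub_ellM (v : ℤ × ℤ) : ellP P v - ellM P v = 2 * rt P * v.2 := by
  rw [ellP, ellM]; ring

/-- `ℓ±(−v) = −ℓ±(v)`. [folklore] -/
theorem ellP_neg (v : ℤ × ℤ) : ellP P (-v) = -ellP P v := by
  simp only [ellP, Prod.fst_neg, Prod.snd_neg, Int.cast_neg]; ring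

/-- `ℓ±(−v) = −ℓ±(v)`. [folklore] -/
theorem ellM_neg (v : ℤ × ℤ) : ellM P (-v) = -ellM P v := by
  simp only [ellM, Prod.fst_neg, Prod.snd_neg, Int.cast_neg]; ring

/-- **The automorph scales `ℓ₊` by `η`.** [folklore] -/
theorem ellP_vecAct_pellAut (hΔ : 0 < P.disc) (e : PosPell P.disc) (v : ℤ × ℤ) :
    ellP P (vecAct (pellAut P e) v) = eta P e * ellP P v := by
  have hr := rt_sq hΔ
  have hd : ((P.disc : ℤ) : ℝ) = (P.b : ℝ) ^ 2 - 4 * P.a * P.c := by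
    rw [BinQF.disc]; push_cast; ring
  rw [hd] at hr
  rw [vecAct_pellAut, ellP, ellP, eta]
  push_cast
  linear_combination (-(v.2 : ℝ) * e.y) * hr

/-- **The automorph scales `ℓ₋` by `η⁻¹`.** [folklore] -/
theorem ellM_vecAct_pellAut (hΔ : 0 < P.disc) (e : PosPell P.disc) (v : ℤ × ℤ) :
    ellM P (vecAct (pellAut P e) v) = (eta P e)⁻¹ * ellM P v := by
  have hr := rt_sq hΔ
  have hd : ((P.disc : ℤ) : ℝ) = (P.b : ℝ) ^ 2 - 4 * P.a * P.c := by
    rw [BinQF.disc]; push_cast; ring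
  rw [hd] at hr
  rw [← conj_eq_eta_inv hΔ e, vecAct_pellAut, ellM, ellM]
  push_cast
  linear_combination (-(v.2 : ℝ) * e.y) * hr

/-- The powers of the automorph scale `ℓ₊` by `η^k` and `ℓ₋` by `η^{−k}`. [folklore] -/
theorem ell_vecAct_zpow (hΔ : 0 < P.disc) (e : PosPell P.disc) (k : ℤ) (v : ℤ × ℤ) :
    ellP P (vecAct (pellAut P e ^ k) v) = eta P e ^ k * ellP P v ∧
      ellM P (vecAct (pellAut P e ^ k) v) = eta P e ^ (-k) * ellM P v := by
  have hη := (eta_pos hΔ e).ne'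
  induction k using Int.induction_on generalizing v with
  | zero => simp
  | succ k ih =>
    rw [zpow_add_one, vecAct_mul]
    obtain ⟨h1, h2⟩ := ih (vecAct (pellAut P e) v)
    rw [h1, h2, ellP_vecAct_pellAut hΔ, ellM_vecAct_pellAut hΔ, zpow_add_one₀ hη,
      show -((k : ℤ) + 1) = -(k : ℤ) + (-1) by ring, zpow_add₀ hη, zpow_neg_one]
    constructor <;> ring
  | pred k ih =>
    rw [zpow_sub_one, vecAct_mul]
    obtain ⟨h1, h2⟩ := ih (vecAct (pellAut P e)⁻¹ v)
    -- `ℓ±(g⁻¹ v)` from `ℓ±(g (g⁻¹ v)) = η^{±1} ℓ±(g⁻¹ v)`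
    have h3 := ellP_vecAct_pellAut hΔ e (vecAct (pellAut P e)⁻¹ v)
    have h4 := ellM_vecAct_pellAut hΔ e (vecAct (pellAut P e)⁻¹ v)
    rw [vecAct_vecAct_inv] at h3 h4
    have h3' : ellP P (vecAct (pellAut P e)⁻¹ v) = (eta P e)⁻¹ * ellP P v := by
      rw [h3]; field_simp
    have h4' : ellM P (vecAct (pellAut P e)⁻¹ v) = eta P e * ellM P v := by
      rw [h4]; field_simp
    rw [h1, h2, h3', h4', zpow_sub_one₀ hη, show -(-(k : ℤ) - 1) = -(-(k : ℤ)) + 1 by ring,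
      zpow_add_one₀ hη]
    constructor <;> ring

/-! ### The sector -/

/-- **The Pell sector** `F = {0 < ℓ₋ ≤ ℓ₊ < η² ℓ₋}`: a fundamental domain for `{±g^k}` on
`{P > 0}`. [cite: Hooley1967, §6 (30)] -/
def sector (P : BinQF) (e : PosPell P.disc) : Set (ℤ × ℤ) :=
  {v | 0 < ellM P v ∧ ellM P v ≤ ellP P v ∧ ellP P v < eta P e ^ 2 * ellM P v}

/-- Membership in the sector. [folklore] -/
theorem mem_sector {e : PosPell P.disc} (v : ℤ × ℤ) :
    v ∈ sector P e ↔ 0 < ellM P v ∧ ellM P v ≤ ellP P v ∧ ellP P v < eta P e ^ 2 * ellM P v := Iff.rfl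

/-- For `u` with `ℓ₋(u), ℓ₊(u) > 0`, the translate `g^k u` lies in the sector iff
`0 ≤ k + t < 1` with `t = log(ℓ₊(u)/ℓ₋(u)) / (2 log η)`. [folklore] -/
theorem zpow_mem_sector_iff (hΔ : 0 < P.disc) (e : PosPell P.disc) {u : ℤ × ℤ} (hM : 0 < ellM P u)
    (hPl : 0 < ellP P u) (k : ℤ) :
    vecAct (pellAut P e ^ k) u ∈ sector P e ↔
      0 ≤ (k : ℝ) + Real.log (ellP P u / ellM P u) / (2 * Real.log (eta P e)) ∧
        (k : ℝ) + Real.log (ellP P u / ellM P u) / (2 * Real.log (eta P e)) < 1 := by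
  obtain ⟨h1, h2⟩ := ell_vecAct_zpow hΔ e k u
  have hη := eta_pos hΔ e
  have hη1 := one_lt_eta hΔ e
  have hlog : 0 < Real.log (eta P e) := Real.log_pos hη1
  have hηk : 0 < eta P e ^ k := zpow_pos hη k
  have hηnk : 0 < eta P e ^ (-k) := zpow_pos hη (-k)
  rw [mem_sector, h1, h2]
  have hMk : 0 < eta P e ^ (-k) * ellM P u := mul_pos hηnk hM
  simp only [hMk, true_and]
  -- the ratio `ρ_k = η^{2k} ρ`
  set ρ : ℝ := ellP P u / ellM P u with hρ
  have hρ0 : 0 < ρ := div_pos hPl hM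
  have hratio : eta P e ^ k * ellP P u = (eta P e ^ (2 * k) * ρ) * (eta P e ^ (-k) * ellM P u) := by
    rw [hρ, show (2 * k : ℤ) = k + k by ring, zpow_add₀ hη.ne', zpow_neg]
    field_simp
  rw [hratio]
  have hX : 0 < eta P e ^ (2 * k) * ρ := mul_pos (zpow_pos hη _) hρ0
  rw [le_mul_iff_one_le_left hMk, mul_lt_mul_iff_of_pos_right hMk]
  -- take logarithms
  have hlogX : Real.log (eta P e ^ (2 * k) * ρ) = 2 * k * Real.log (eta P e) + Real.log ρ := by
    rw [Real.log_mul (zpow_pos hη _).ne' hρ0.ne', Real.log_zpow]; push_cast; ring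
  have e1 : 1 ≤ eta P e ^ (2 * k) * ρ ↔ 0 ≤ (k : ℝ) + Real.log ρ / (2 * Real.log (eta P e)) := by
    rw [← Real.log_nonneg_iff hX, hlogX]
    constructor
    · intro h
      have : 0 ≤ (2 * k * Real.log (eta P e) + Real.log ρ) / (2 * Real.log (eta P e)) :=
        div_nonneg h (by positivity)
      have heq : (2 * k * Real.log (eta P e) + Real.log ρ) / (2 * Real.log (eta P e)) =
          (k : ℝ) + Real.log ρ / (2 * Real.log (eta P e)) := by field_simp
      linarith [heq]
    · intro h
      have := mul_nonneg h (by positivity : 0 ≤ 2 * Real.log (eta P e))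
      have heq : ((k : ℝ) + Real.log ρ / (2 * Real.log (eta P e))) * (2 * Real.log (eta P e)) =
          2 * k * Real.log (eta P e) + Real.log ρ := by field_simp
      linarith [heq]
  have e2 : eta P e ^ (2 * k) * ρ < eta P e ^ 2 ↔ (k : ℝ) + Real.log ρ / (2 * Real.log (eta P e)) < 1 := by
    rw [← Real.log_lt_log_iff hX (by positivity), hlogX, Real.log_pow]
    push_cast
    constructor
    · intro h
      have h' : ((k : ℝ) + Real.log ρ / (2 * Real.log (eta P e))) * (2 * Real.log (eta P e)) <
          1 * (2 * Real.log (eta P e)) := by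
        have heq : ((k : ℝ) + Real.log ρ / (2 * Real.log (eta P e))) * (2 * Real.log (eta P e)) =
            2 * k * Real.log (eta P e) + Real.log ρ := by field_simp
        rw [heq]; linarith
      exact lt_of_mul_lt_mul_right h' (by positivity)
    · intro h
      have := mul_lt_mul_of_pos_right h (by positivity : 0 < 2 * Real.log (eta P e))
      have heq : ((k : ℝ) + Real.log ρ / (2 * Real.log (eta P e))) * (2 * Real.log (eta P e)) =
          2 * k * Real.log (eta P e) + Real.log ρ := by field_simp
      linarith [heq]
  rw [e1, e2]

/-- `vecAct γ (−w) = −vecAct γ w`. [folklore] -/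
theorem vecAct_neg_right (γ : SL(2, ℤ)) (w : ℤ × ℤ) : vecAct γ (-w) = -vecAct γ w := by
  ext <;> simp [vecAct] <;> ring

/-- **The sector is a fundamental domain for `{±g^k}` on `{P > 0}`.** [folklore] -/
theorem sector_fund (hA : 0 < P.a) (hΔ : 0 < P.disc) (e : PosPell P.disc) (w : ℤ × ℤ)
    (hw : 0 < P.eval w.1 w.2) :
    ∃! v, v ∈ sector P e ∧ ∃ s ∈ signedZpowers (pellAut P e), v = vecAct s w := by
  have hη := eta_pos hΔ e
  have hlog : 0 < Real.log (eta P e) := Real.log_pos (one_lt_eta hΔ e)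
  have hprod : 0 < ellP P w * ellM P w := by
    rw [ellP_mul_ellM hΔ]
    have : (0 : ℝ) < P.eval w.1 w.2 := by exact_mod_cast hw
    have : (0 : ℝ) < P.a := by exact_mod_cast hA
    positivity
  -- normalise to `ℓ₋ > 0`
  obtain ⟨u, σ, hσ, hu, hMu⟩ : ∃ (u : ℤ × ℤ) (σ : SL(2, ℤ)), (σ = 1 ∨ σ = -1) ∧ u = vecAct σ w ∧ 0 < ellM P u := by
    by_cases hpos : 0 < ellM P w
    · exact ⟨w, 1, Or.inl rfl, (vecAct_one w).symm, hpos⟩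
    · refine ⟨-w, -1, Or.inr rfl, by rw [vecAct_neg, vecAct_one], ?_⟩
      rw [ellM_neg]
      have : ellM P w ≠ 0 := fun h0 => by rw [h0, mul_zero] at hprod; exact lt_irrefl _ hprod
      push Not at hpos
      have := lt_of_le_of_ne hpos this
      linarith
  have hprodu : 0 < ellP P u * ellM P u := by
    rcases hσ with rfl | rfl
    · rw [vecAct_one] at hu; rw [hu]; exact hprod
    · rw [vecAct_neg, vecAct_one] at hu; rw [hu, ellP_neg, ellM_neg]; nlinarith
  have hPu : 0 < ellP P u := by
    by_contra hcon
    push Not at hcon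
    have := mul_nonpos_of_nonpos_of_nonneg hcon hMu.le
    linarith
  have hσmem : σ ∈ signedZpowers (pellAut P e) := by
    rcases hσ with rfl | rfl
    · exact (signedZpowers _).one_mem
    · exact ⟨0, Or.inr (by rw [zpow_zero])⟩
  have hσσ : σ * σ = 1 := by
    rcases hσ with rfl | rfl
    · rw [one_mul]
    · rw [neg_mul_neg, one_mul]
  have hwu : w = vecAct σ u := by rw [hu, ← vecAct_mul, hσσ, vecAct_one]
  -- the exponent
  set t : ℝ := Real.log (ellP P u / ellM P u) / (2 * Real.log (eta P e)) with ht
  set k₀ : ℤ := -⌊t⌋ with hk₀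
  have hk₀t : 0 ≤ (k₀ : ℝ) + t ∧ (k₀ : ℝ) + t < 1 := by
    have h1 := Int.floor_le t
    have h2 := Int.lt_floor_add_one t
    rw [hk₀]; push_cast
    constructor <;> linarith
  set v₀ := vecAct (pellAut P e ^ k₀) u with hv₀
  have hv₀F : v₀ ∈ sector P e := (zpow_mem_sector_iff hΔ e hMu hPu k₀).2 hk₀t
  refine ⟨v₀, ⟨hv₀F, pellAut P e ^ k₀ * σ, (signedZpowers _).mul_mem ⟨k₀, Or.inl rfl⟩ hσmem,
    by rw [vecAct_mul, ← hu]⟩, ?_⟩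
  -- uniqueness
  rintro v ⟨hvF, s, hs, rfl⟩
  have hsσ : s * σ ∈ signedZpowers (pellAut P e) := (signedZpowers _).mul_mem hs hσmem
  obtain ⟨k, hk⟩ := hsσ
  have hv : vecAct s w = vecAct (s * σ) u := by rw [hwu, vecAct_mul]
  rw [hv] at hvF ⊢
  rcases hk with hk | hk
  · rw [hk] at hvF ⊢
    have hkt := (zpow_mem_sector_iff hΔ e hMu hPu k).1 hvF
    have hkk : k = k₀ := by
      have h1 : ((k - k₀ : ℤ) : ℝ) < 1 := by push_cast; linarith [hkt.2, hk₀t.1]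
      have h2 : (-1 : ℝ) < ((k - k₀ : ℤ) : ℝ) := by push_cast; linarith [hkt.1, hk₀t.2]
      have h1' : k - k₀ < 1 := by exact_mod_cast h1
      have h2' : -1 < k - k₀ := by exact_mod_cast h2
      omega
    rw [hkk]
  · exfalso
    rw [hk, vecAct_neg, mem_sector, ellM_neg, (ell_vecAct_zpow hΔ e k u).2] at hvF
    have : 0 < eta P e ^ (-k) * ellM P u := mul_pos (zpow_pos hη _) hMu
    linarith [hvF.1]

/-- The sector lies in the closed upper half-plane. [folklore] -/
theorem snd_nonneg_of_mem_sector (hΔ : 0 < P.disc) {e : PosPell P.disc} {v : ℤ × ℤ}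
    (hv : v ∈ sector P e) : 0 ≤ v.2 := by
  obtain ⟨-, h1, -⟩ := hv
  have h := ellP_sub_ellM (P := P) v
  have hs := rt_pos hΔ
  have : (0 : ℝ) ≤ v.2 := by nlinarith
  exact_mod_cast this

/-- The sector meets the axis `r = 0` in `p > 0`. [folklore] -/
theorem mem_sector_axis_iff (hA : 0 < P.a) (hΔ : 0 < P.disc) (e : PosPell P.disc) (p : ℤ) :
    (p, (0 : ℤ)) ∈ sector P e ↔ 0 < p := by
  have hη := one_lt_eta hΔ e
  have hη2 : 1 < eta P e ^ 2 := by nlinarith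
  have hA' : (0 : ℝ) < P.a := by exact_mod_cast hA
  have hM : ellM P (p, 0) = 2 * P.a * p := by simp [ellM]
  have hPl : ellP P (p, 0) = 2 * P.a * p := by simp [ellP]
  rw [mem_sector, hM, hPl]
  constructor
  · rintro ⟨h0, -, -⟩
    have : (0 : ℝ) < p := by nlinarith
    exact_mod_cast this
  · intro hp
    have hp' : (0 : ℝ) < p := by exact_mod_cast hp
    have h0 : (0 : ℝ) < 2 * P.a * p := by positivity
    exact ⟨h0, le_rfl, by nlinarith⟩

/-! ### The slices of the sector -/

section slices

variable (P) (e : PosPell P.disc)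

/-- `γ = √Δ (η² + 1)/(η² − 1)`: the slope of the lower edge of the sector (`(p, r) ∈ F ⇔
2Ap + Br > γ r` for `r > 0`). [folklore] -/
def gammaC : ℝ := rt P * (eta P e ^ 2 + 1) / (eta P e ^ 2 - 1)

/-- `κ = √(4A/(γ² − Δ))`: `P(p, r) ≤ N` on the sector forces `r < κ√N`. [folklore] -/
def kappaC : ℝ := Real.sqrt (4 * P.a / (gammaC P e ^ 2 - P.disc))

/-- The last slice `R_N = ⌈κ√N⌉`. [folklore] -/
def iR (N : ℕ) : ℕ := ⌈kappaC P e * Real.sqrt N⌉₊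

/-- `⌊√(4AN + Δr²)⌋`. [folklore] -/
def iS (N r : ℕ) : ℤ := ((Nat.sqrt (4 * P.a * N + P.disc * (r : ℤ) ^ 2).toNat : ℕ) : ℤ)

/-- Left end of the slice: `a < p ⇔ ⌊γr⌋ < 2Ap + Br`. [folklore] -/
def iLeft (r : ℕ) : ℤ := (⌊gammaC P e * r⌋ - P.b * r) / (2 * P.a)

/-- Right end of the slice: `p < b ⇔ 2Ap + Br ≤ ⌊√(4AN + Δr²)⌋` (cut off at `a` when that is
smaller). [folklore] -/
def iRight (N r : ℕ) : ℤ := max ((iS P N r - P.b * r) / (2 * P.a) + 1) (iLeft P e r)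

variable {P} {e}

/-- `γ > √Δ ≥ 1` and `γ² > Δ`. [folklore] -/
theorem gammaC_gt (hΔ : 0 < P.disc) : rt P < gammaC P e ∧ 0 < gammaC P e ∧ (P.disc : ℝ) < gammaC P e ^ 2 := by
  have hs := rt_pos hΔ
  have hη := one_lt_eta hΔ e
  have hη2 : 0 < eta P e ^ 2 - 1 := by nlinarith
  have h1 : rt P < gammaC P e := by
    rw [gammaC, lt_div_iff₀ hη2]; nlinarith
  refine ⟨h1, hs.trans h1, ?_⟩
  rw [← rt_sq hΔ]
  exact pow_lt_pow_left₀ h1 hs.le two_ne_zero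

/-- **The sector at height `r > 0`**: `(p, r) ∈ F ⇔ γ r < 2Ap + Br`. [cite: Hooley1967, §6 (32)] -/
theorem mem_sector_iff_gt (hΔ : 0 < P.disc) (e : PosPell P.disc) {p r : ℤ} (hr : 0 < r) :
    (p, r) ∈ sector P e ↔ gammaC P e * r < (2 * P.a * p + P.b * r : ℝ) := by
  have hs := rt_pos hΔ
  have hη := one_lt_eta hΔ e
  have hη2 : 0 < eta P e ^ 2 - 1 := by nlinarith
  have hr' : (0 : ℝ) < r := by exact_mod_cast hr
  obtain ⟨hγs, hγ0, -⟩ := gammaC_gt (e := e) hΔ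
  have hM : ellM P (p, r) = (2 * P.a * p + P.b * r) - rt P * r := by simp only [ellM]; ring
  have hPl : ellP P (p, r) = (2 * P.a * p + P.b * r) + rt P * r := by simp only [ellP]; ring
  set u : ℝ := 2 * P.a * p + P.b * r with hu
  have hγr : gammaC P e * r = rt P * (eta P e ^ 2 + 1) * r / (eta P e ^ 2 - 1) := by
    rw [gammaC]; ring
  rw [mem_sector, hM, hPl, hγr, div_lt_iff₀ hη2]
  constructor
  · rintro ⟨-, -, h2⟩
    nlinarith
  · intro h
    have hsr : rt P * r < u := by
      have : rt P * r * (eta P e ^ 2 - 1) ≤ rt P * (eta P e ^ 2 + 1) * r := by nlinarith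
      nlinarith
    refine ⟨by linarith, by nlinarith, by nlinarith⟩

/-- **The slices of the sector**: for `A > 0`, `Δ > 0` non-square (through `e`), `N, r ≥ 1` and
any `p`, `(p, r) ∈ F ∧ 0 < P(p, r) ≤ N ⇔ r ≤ R_N ∧ iLeft < p < iRight`.
[cite: Hooley1967, §6 (32)–(33)] -/
theorem indefinite_slice (hA : 0 < P.a) (hΔ : 0 < P.disc) (e : PosPell P.disc) (N : ℕ) (r : ℕ)
    (hr : 1 ≤ r) (p : ℤ) :
    ((p, (r : ℤ)) ∈ sector P e ∧ 0 < P.eval p r ∧ P.eval p r ≤ N) ↔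
      (r ≤ iR P e N ∧ iLeft P e r < p ∧ p < iRight P e N r) := by
  have hA2 : (0 : ℤ) < 2 * P.a := by linarith
  have hr0 : (0 : ℤ) < r := by exact_mod_cast hr
  have hr' : (0 : ℝ) < r := by exact_mod_cast hr
  obtain ⟨hγs, hγ0, hγΔ⟩ := gammaC_gt (e := e) hΔ
  have hid := P.four_mul_a_mul_eval p r
  set ui : ℤ := 2 * P.a * p + P.b * r with hui
  set M : ℤ := 4 * P.a * N + P.disc * (r : ℤ) ^ 2 with hMdef
  have hM0 : 0 ≤ M := by rw [hMdef]; positivity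
  set G : ℤ := ⌊gammaC P e * r⌋ with hG
  have hG0 : 0 ≤ G := Int.floor_nonneg.2 (by positivity)
  have huc : (ui : ℝ) = 2 * P.a * p + P.b * r := by rw [hui]; push_cast; ring
  -- the sector condition
  have hsec : (p, (r : ℤ)) ∈ sector P e ↔ G < ui := by
    rw [mem_sector_iff_gt hΔ e hr0, Int.cast_natCast, ← huc, hG, Int.floor_lt]
  -- positivity of `P` on the slice
  have hpos : G < ui → 0 < P.eval p r := by
    intro h
    have hmem := hsec.2 h
    obtain ⟨h0, h1, -⟩ := hmem
    have hprod : 0 < ellP P (p, (r : ℤ)) * ellM P (p, (r : ℤ)) := mul_pos (by linarith) h0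
    rw [ellP_mul_ellM hΔ] at hprod
    have hA' : (0 : ℝ) < 4 * P.a := by positivity
    have : (0 : ℝ) < (P.eval p r : ℝ) := pos_of_mul_pos_right hprod hA'.le
    exact_mod_cast this
  -- `P ≤ N ⇔ ui² ≤ M`
  have hPN : P.eval p r ≤ N ↔ ui ^ 2 ≤ M := by
    constructor
    · intro h; rw [hMdef]; nlinarith
    · intro h; rw [hMdef] at h; nlinarith
  -- the integer form of the two conditions
  have hL : iLeft P e r < p ↔ G < ui := by
    rw [iLeft, ← hG, Int.ediv_lt_iff_lt_mul hA2, hui]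
    constructor <;> intro h <;> linarith
  have hRt : p < (iS P N r - P.b * r) / (2 * P.a) + 1 ↔ ui ≤ iS P N r := by
    rw [← mul_le_iff_lt_ediv_add_one hA2, hui]
    constructor <;> intro h <;> linarith
  have hsq : G < ui → (ui ^ 2 ≤ M ↔ ui ≤ iS P N r) := by
    intro h
    rw [sq_le_iff_abs_le_sqrt hM0, iS, ← hMdef]
    constructor
    · exact fun h' => h'.2
    · intro h'; exact ⟨by linarith, h'⟩
  -- `r ≤ R_N` on the slice
  have hRN : G < ui → ui ≤ iS P N r → r ≤ iR P e N := by
    intro h1 h2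
    have hu1 : gammaC P e * r < (ui : ℝ) := by
      have := Int.floor_lt.1 (show ⌊gammaC P e * r⌋ < ui from h1); exact this
    have hu2 : (ui : ℝ) ≤ Real.sqrt (M : ℝ) := by
      have h3 : (ui : ℝ) ≤ ((Nat.sqrt M.toNat : ℕ) : ℝ) := by exact_mod_cast h2
      have h4 : ((Nat.sqrt M.toNat : ℕ) : ℝ) ≤ Real.sqrt ((M.toNat : ℕ) : ℝ) := Real.nat_sqrt_le_real_sqrt
      have h5 : ((M.toNat : ℕ) : ℝ) = (M : ℝ) := by
        have : ((M.toNat : ℕ) : ℤ) = M := Int.toNat_of_nonneg hM0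
        exact_mod_cast this
      rw [h5] at h4
      exact h3.trans h4
    have hγr0 : 0 ≤ gammaC P e * r := by positivity
    have h6 : (gammaC P e * r) ^ 2 < (M : ℝ) := by
      have h7 : gammaC P e * r < Real.sqrt M := hu1.trans_le hu2
      have h8 : (gammaC P e * r) ^ 2 < Real.sqrt M ^ 2 := pow_lt_pow_left₀ h7 hγr0 two_ne_zero
      rwa [Real.sq_sqrt (by exact_mod_cast hM0)] at h8
    have hMr : (M : ℝ) = 4 * P.a * N + P.disc * (r : ℝ) ^ 2 := by rw [hMdef]; push_cast; ring
    rw [hMr] at h6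
    -- `(γ² − Δ) r² < 4AN`, so `r < κ √N`
    have hpos' : 0 < gammaC P e ^ 2 - P.disc := by linarith
    have h9 : (r : ℝ) ^ 2 < 4 * P.a / (gammaC P e ^ 2 - P.disc) * N := by
      rw [div_mul_eq_mul_div, lt_div_iff₀ hpos']; nlinarith
    have h10 : (r : ℝ) < kappaC P e * Real.sqrt N := by
      rw [kappaC, ← Real.sqrt_mul (by positivity)]
      exact Real.lt_sqrt_of_sq_lt h9
    have h11 : (r : ℝ) ≤ (iR P e N : ℝ) := h10.le.trans (Nat.le_ceil _)
    exact_mod_cast h11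
  -- assemble
  rw [hsec, hPN, iRight]
  constructor
  · rintro ⟨h1, -, h3⟩
    have h4 := (hsq h1).1 h3
    refine ⟨hRN h1 h4, hL.2 h1, lt_max_of_lt_left (hRt.2 h4)⟩
  · rintro ⟨-, h2, h3⟩
    have h1 := hL.1 h2
    rcases lt_max_iff.1 h3 with h3 | h3
    · have h4 := hRt.1 h3
      exact ⟨h1, hpos h1, (hsq h1).2 h4⟩
    · exact absurd (h2.trans h3) (lt_irrefl _)

/-- `R_N ≤ (κ + 1)√N` for `N ≥ 1`. [folklore] -/
theorem iR_le (e : PosPell P.disc) {N : ℕ} (hN : 1 ≤ N) :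
    (iR P e N : ℝ) ≤ (kappaC P e + 1) * Real.sqrt N := by
  have hκ : 0 ≤ kappaC P e := Real.sqrt_nonneg _
  have hN' : (1 : ℝ) ≤ N := by exact_mod_cast hN
  have hsN : 1 ≤ Real.sqrt N := by rw [← Real.sqrt_one]; exact Real.sqrt_le_sqrt hN'
  have h1 : (iR P e N : ℝ) < kappaC P e * Real.sqrt N + 1 := Nat.ceil_lt_add_one (by positivity)
  nlinarith

/-- Length of the slices: `iLeft ≤ iRight` and `iRight − iLeft ≤ (√(4A + Δ(κ+1)²) + 2)√N` for
`N ≥ 1`, `1 ≤ r ≤ R_N`. [folklore] -/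
theorem indefinite_ab_le (hA : 0 < P.a) (hΔ : 0 < P.disc) (e : PosPell P.disc) {N : ℕ} (hN : 1 ≤ N)
    {r : ℕ} (hr : r ∈ Finset.Icc 1 (iR P e N)) :
    iLeft P e r ≤ iRight P e N r ∧
      ((iRight P e N r - iLeft P e r : ℤ) : ℝ) ≤
        (Real.sqrt (4 * P.a + P.disc * (kappaC P e + 1) ^ 2) + 2) * Real.sqrt N := by
  obtain ⟨hr1, hrR⟩ := Finset.mem_Icc.1 hr
  refine ⟨le_max_right _ _, ?_⟩
  have hN' : (1 : ℝ) ≤ N := by exact_mod_cast hN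
  have hsN : 1 ≤ Real.sqrt N := by rw [← Real.sqrt_one]; exact Real.sqrt_le_sqrt hN'
  have hA2 : (0 : ℤ) < 2 * P.a := by linarith
  have hA1 : (1 : ℝ) ≤ P.a := by exact_mod_cast (show (1 : ℤ) ≤ P.a by omega)
  set S : ℤ := iS P N r with hSdef
  set G : ℤ := ⌊gammaC P e * r⌋ with hG
  set M : ℤ := 4 * P.a * N + P.disc * (r : ℤ) ^ 2 with hMdef
  have hM0 : 0 ≤ M := by rw [hMdef]; positivity
  have hG0 : 0 ≤ G := Int.floor_nonneg.2 (by have := (gammaC_gt (e := e) hΔ).2.1; positivity)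
  have hS0 : 0 ≤ S := by rw [hSdef, iS]; positivity
  set c : ℝ := Real.sqrt (4 * P.a + P.disc * (kappaC P e + 1) ^ 2) with hc
  have hc0 : 0 ≤ c := Real.sqrt_nonneg _
  -- `S ≤ c √N`
  have hSle : (S : ℝ) ≤ c * Real.sqrt N := by
    have h1 : (S : ℝ) ≤ Real.sqrt ((M.toNat : ℕ) : ℝ) := by
      rw [hSdef, iS, ← hMdef]; push_cast; exact Real.nat_sqrt_le_real_sqrt
    have h2 : ((M.toNat : ℕ) : ℝ) = (M : ℝ) := by
      have : ((M.toNat : ℕ) : ℤ) = M := Int.toNat_of_nonneg hM0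
      exact_mod_cast this
    have hRle := iR_le (P := P) e hN
    have hrR' : (r : ℝ) ≤ (kappaC P e + 1) * Real.sqrt N := le_trans (by exact_mod_cast hrR) hRle
    have hκ : 0 ≤ kappaC P e := Real.sqrt_nonneg _
    have hr2 : (r : ℝ) ^ 2 ≤ (kappaC P e + 1) ^ 2 * N := by
      have := pow_le_pow_left₀ (by positivity) hrR' 2
      rw [mul_pow, Real.sq_sqrt (by positivity)] at this
      exact this
    have hΔ' : (0 : ℝ) ≤ P.disc := by exact_mod_cast hΔ.le
    have h3 : (M : ℝ) ≤ (4 * P.a + P.disc * (kappaC P e + 1) ^ 2) * N := by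
      rw [hMdef]; push_cast
      nlinarith [mul_le_mul_of_nonneg_left hr2 hΔ']
    calc (S : ℝ) ≤ Real.sqrt (M : ℝ) := by rw [← h2]; exact h1
      _ ≤ Real.sqrt ((4 * P.a + P.disc * (kappaC P e + 1) ^ 2) * N) := Real.sqrt_le_sqrt h3
      _ = c * Real.sqrt N := by rw [hc, Real.sqrt_mul (by positivity)]
  rcases le_or_gt ((S - P.b * r) / (2 * P.a) + 1) (iLeft P e r) with hle | hlt
  · rw [iRight, max_eq_right hle, sub_self, Int.cast_zero]
    positivity
  · rw [iRight, max_eq_left hlt.le, iLeft, ← hG]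
    have hX : (((S - P.b * r) / (2 * P.a) : ℤ) : ℝ) ≤ ((S - P.b * r : ℤ) : ℝ) / ((2 * P.a : ℤ) : ℝ) := by
      rw [le_div_iff₀ (by exact_mod_cast hA2)]
      exact_mod_cast Int.ediv_mul_le _ hA2.ne'
    have hY : ((G - P.b * r : ℤ) : ℝ) / ((2 * P.a : ℤ) : ℝ) - 1 ≤ (((G - P.b * r) / (2 * P.a) : ℤ) : ℝ) := by
      rw [sub_le_iff_le_add, div_le_iff₀ (by exact_mod_cast hA2)]
      exact_mod_cast (Int.lt_ediv_add_one_mul_self (G - P.b * r) hA2).le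
    have hfrac : ((S - P.b * r : ℤ) : ℝ) / ((2 * P.a : ℤ) : ℝ) -
        ((G - P.b * r : ℤ) : ℝ) / ((2 * P.a : ℤ) : ℝ) ≤ S := by
      rw [← sub_div, div_le_iff₀ (by push_cast; linarith)]
      push_cast
      have hS0' : (0 : ℝ) ≤ S := by exact_mod_cast hS0
      have hG0' : (0 : ℝ) ≤ G := by exact_mod_cast hG0
      nlinarith
    push_cast at hX hY hfrac ⊢
    nlinarith

/-- **The twist on a slice of the sector**: for `1 ≤ r ≤ R_N` and `iLeft < p < iRight`,
`|e(−h(2Ap + Br)/(2rP(p,r))) − 1| ≤ 2πAη²|h|/r²` — on the sector `(2Ap + Br)·r ≤ ℓ₊²/2 < η²ℓ₊ℓ₋/2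
= 2η²A·P(p, r)`. [cite: Hooley1967, §6 (34)] -/
theorem indefinite_twist_le (hA : 0 < P.a) (hΔ : 0 < P.disc) (e : PosPell P.disc) (h : ℤ) {N : ℕ}
    {r : ℕ} (hr : r ∈ Finset.Icc 1 (iR P e N)) {p : ℤ}
    (hp : p ∈ Finset.Ioo (iLeft P e r) (iRight P e N r)) :
    ‖twist P h r p - 1‖ ≤ (2 * Real.pi * P.a * eta P e ^ 2 * |(h : ℝ)|) / (r : ℝ) ^ 2 := by
  obtain ⟨hr1, hrR⟩ := Finset.mem_Icc.1 hr
  obtain ⟨hpa, hpb⟩ := Finset.mem_Ioo.1 hp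
  obtain ⟨hmem, hPpos, -⟩ := (indefinite_slice hA hΔ e N r hr1 p).2 ⟨hrR, hpa, hpb⟩
  obtain ⟨h0, h1, h2⟩ := hmem
  have hs1 := one_le_rt hΔ
  have hr' : (1 : ℝ) ≤ r := by exact_mod_cast hr1
  have hA' : (0 : ℝ) < P.a := by exact_mod_cast hA
  have hP' : (0 : ℝ) < (P.eval p r : ℝ) := by exact_mod_cast hPpos
  have hprod := ellP_mul_ellM hΔ (P := P) (p, (r : ℤ))
  have hdiff := ellP_sub_ellM (P := P) (p, (r : ℤ))
  simp only [Int.cast_natCast] at hprod hdiff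
  set u : ℝ := 2 * P.a * p + P.b * r with hu
  have huP : u = ellP P (p, (r : ℤ)) - rt P * r := by simp only [ellP, hu, Int.cast_natCast]; ring
  have hPl0 : 0 < ellP P (p, (r : ℤ)) := by linarith
  have hu0 : 0 ≤ u := by
    rw [huP]
    have : rt P * r ≤ ellP P (p, (r : ℤ)) - ellM P (p, (r : ℤ)) := by rw [hdiff]; nlinarith
    nlinarith
  -- `u r ≤ 2 η² A P`
  have hkey : u * r ≤ 2 * eta P e ^ 2 * P.a * (P.eval p r : ℝ) := by
    have hu_le : u ≤ ellP P (p, (r : ℤ)) := by rw [huP]; nlinarith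
    have hr_le : 2 * (r : ℝ) ≤ ellP P (p, (r : ℤ)) := by nlinarith
    calc u * r ≤ ellP P (p, (r : ℤ)) * (ellP P (p, (r : ℤ)) / 2) := by
          apply mul_le_mul hu_le (by linarith) (by positivity) hPl0.le
      _ ≤ eta P e ^ 2 * ellM P (p, (r : ℤ)) * ellP P (p, (r : ℤ)) / 2 := by nlinarith
      _ = 2 * eta P e ^ 2 * P.a * (P.eval p r : ℝ) := by
          rw [mul_assoc, mul_comm (ellM P _), hprod]; ring
  rw [twist_eq_fourierChar]
  -- `|e(x) − 1| ≤ 2π|x|` (cf. the tree's `CircleMethodKernel.norm_fourierChar_sub_one_le`)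
  have hlip : ∀ x : ℝ, ‖(Real.fourierChar x : ℂ) - 1‖ ≤ 2 * Real.pi * |x| := fun x => by
    rw [Vinogradov.norm_fourierChar_sub_one]
    have := Real.abs_sin_le_abs (x := Real.pi * x)
    rw [abs_mul, abs_of_pos Real.pi_pos] at this
    linarith
  refine (hlip _).trans ?_
  have hucast : ((2 * P.a * p + P.b * r : ℤ) : ℝ) = u := by rw [hu]; push_cast; ring
  rw [hucast, abs_neg, abs_div, abs_mul, abs_of_nonneg hu0,
    show |(2 : ℝ) * (r : ℝ) * (P.eval p r : ℝ)| = 2 * r * (P.eval p r : ℝ) by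
      rw [abs_of_pos (by positivity)],
    show 2 * Real.pi * (|(h : ℝ)| * u / (2 * r * (P.eval p r : ℝ))) =
      (2 * Real.pi * |(h : ℝ)| * u) / (2 * r * (P.eval p r : ℝ)) by ring,
    div_le_div_iff₀ (by positivity) (by positivity)]
  have hh0 : 0 ≤ |(h : ℝ)| := abs_nonneg _
  have hpi : 0 < Real.pi := Real.pi_pos
  have h1 := mul_le_mul_of_nonneg_left hkey (by positivity : 0 ≤ 2 * Real.pi * |(h : ℝ)| * r)
  nlinarith [h1]

/-- **Slice data for an indefinite class** (`A > 0`, `Δ > 0` non-square, through a positive Pell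
unit `e`): `G' = {±g^k}` for the Pell automorph `g`, the sector `F`, `R_N = ⌈κ√N⌉`, the slices of
`indefinite_slice`, and the constants `c₁ = κ + 1`, `c₂ = √(4A + Δ(κ+1)²) + 2`, `c₃ = 2πAη²|h|`.
[cite: Hooley1967, §6 (30)–(35)] -/
def indefiniteData (P : BinQF) (h : ℤ) (hA : 0 < P.a) (hΔ : 0 < P.disc) (e : PosPell P.disc) :
    SliceData P h where
  F := sector P e
  G' := signedZpowers (pellAut P e)
  R := iR P e
  a := fun _ r => iLeft P e r
  b := fun N r => iRight P e N r
  c₁ := kappaC P e + 1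
  c₂ := Real.sqrt (4 * P.a + P.disc * (kappaC P e + 1) ^ 2) + 2
  c₃ := 2 * Real.pi * P.a * eta P e ^ 2 * |(h : ℝ)|
  hc₁ := by have := Real.sqrt_nonneg (4 * P.a / (gammaC P e ^ 2 - P.disc)); rw [kappaC]; positivity
  hc₂ := by positivity
  hc₃ := mul_nonneg (mul_nonneg (mul_nonneg (by positivity) (by exact_mod_cast hA.le))
    (sq_nonneg _)) (abs_nonneg _)
  le_stab := signedZpowers_le_stab (pellAut_mem_stab P e)
  fund := sector_fund hA hΔ e
  snd_nonneg := fun v hv => snd_nonneg_of_mem_sector hΔ hv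
  fst_axis := mem_sector_axis_iff hA hΔ e
  slice := fun N _ r hr p => indefinite_slice hA hΔ e N r hr p
  R_le := fun N hN => iR_le e hN
  ab_le := fun N hN r hr => indefinite_ab_le hA hΔ e hN hr
  twist_le := fun N _ r hr p hp => indefinite_twist_le hA hΔ e h hr hp

/-- **Hooley's bound for an indefinite class**: for `P` with `A > 0`, `Δ > 0` non-square and
`h ≠ 0`, `∑_{Q T-reduced ∼ P, 0 < A_Q ≤ N} e(h B_Q/(2A_Q)) = O(N^{3/4} (log N)²)`.
[cite: Hooley1963, §6] -/
theorem isBigO_sum_class_of_disc_pos {P : BinQF} (hA : 0 < P.a) (hΔpos : 0 < P.disc)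
    (hΔ : ¬ IsSquare P.disc) {h : ℤ} (hh : h ≠ 0) (S : ℕ → Finset BinQF)
    (hS : ∀ N Q, Q ∈ S N ↔ (∃ ξ : SL(2, ℤ), Q = smul P ξ) ∧ IsTReduced Q ∧ 0 < Q.a ∧ Q.a ≤ N) :
    (fun N : ℕ => ∑ Q ∈ S N, classWeight h Q) =O[atTop]
      fun N : ℕ => (N : ℝ) ^ (3 / 4 : ℝ) * Real.log N ^ 2 :=
  (indefiniteData P h hA hΔpos (nonempty_posPell hΔpos hΔ).some).isBigO_sum_class hA hΔ hh S hS

/-- **Hooley's bound for one class, either sign**: for `P` with `A > 0`, non-square discriminant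
and `h ≠ 0`, `∑_{Q T-reduced ∼ P, 0 < A_Q ≤ N} e(h B_Q/(2A_Q)) = O(N^{3/4} (log N)²)`.
[cite: Hooley1963, §6] -/
theorem isBigO_sum_class {P : BinQF} (hA : 0 < P.a) (hΔ : ¬ IsSquare P.disc) {h : ℤ} (hh : h ≠ 0)
    (S : ℕ → Finset BinQF)
    (hS : ∀ N Q, Q ∈ S N ↔ (∃ ξ : SL(2, ℤ), Q = smul P ξ) ∧ IsTReduced Q ∧ 0 < Q.a ∧ Q.a ≤ N) :
    (fun N : ℕ => ∑ Q ∈ S N, classWeight h Q) =O[atTop]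
      fun N : ℕ => (N : ℝ) ^ (3 / 4 : ℝ) * Real.log N ^ 2 := by
  have h0 : P.disc ≠ 0 := fun h0 => hΔ ⟨0, by rw [h0]; ring⟩
  rcases lt_or_gt_of_ne h0 with hneg | hpos
  · exact isBigO_sum_class_of_disc_neg hA hneg hh S hS
  · exact isBigO_sum_class_of_disc_pos hA hpos hΔ hh S hS

end slices

end Hooley1963

end Literature.NumberTheory.Sieve

end

/-! ## Part III — the theorem: from roots to classes, and the corrected named fact -/

noncomputable section

namespace Literature.NumberTheory.Sieve

open scoped BigOperators MatrixGroups Polynomial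
open Finset Filter Asymptotics Polynomial
open Literature.NumberTheory.QuadraticFields.Quadratic (BinQF)
open RootForms Hooley1963

/-! ### The corrected named fact -/

/-- **Hooley (1963), Theorem 1: power-saving equidistribution of the roots of a quadratic
congruence to all moduli, with the square of the logarithm.**  Let `D` be an integer which is not
a square and `h ≠ 0` an integer.  Then
`∑_{d ≤ N} ∑_{ν mod d, ν² ≡ D (mod d)} e(hν/d) ≪_{D,h} N^{3/4} (log N)²`
(`≪` = `=O[atTop]` in `N : ℕ`; inner sum = `polyRootWeylSum (X ^ 2 - C D) d h`).  This is the
"in particular" clause of Hooley's Theorem 1 as printed: "Let `D` be any fixed integer that is not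
a perfect square, and let `R(h, x) = ∑_{k ≤ x} ∑_{ν² ≡ D (mod k), 0 < ν ≤ k} e^{2πihν/k}`.  Then, for
`h ≠ 0`, … in particular, `|R(h, x)| ≤ A(h) x^{3/4} log² x`" (`A(h)` a constant depending at most
on `h` and `D`, p. 99) [cite: Hooley1963, Theorem 1 (p. 110)]; quoted with the same `(log x)²` in
[cite: DukeFriedlanderIwaniec1995, p. 424 (5)].  It CORRECTS
`hooley1963_quadraticRoots_allModuli_powerSaving` (same statement with `log N` in place of
`(log N)²`, after the misquotation in Dartyge–Martin 2019 §1), see the module docstring; it is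
PROVED below (`hooley1963_quadraticRoots_allModuli_logSqSaving_holds`). -/
def hooley1963_quadraticRoots_allModuli_logSqSaving : Prop :=
  ∀ D : ℤ, ¬IsSquare D → ∀ h : ℤ, h ≠ 0 →
    (fun N : ℕ => ∑ d ∈ Finset.Icc 1 N, polyRootWeylSum (X ^ 2 - C D) d h) =O[atTop]
      fun N : ℕ => (N : ℝ) ^ (3 / 4 : ℝ) * Real.log N ^ 2

/-- `N^{3/4} (log N)² = o(N)` along `ℕ`. [folklore] -/
theorem isLittleO_rpow_three_quarters_mul_log_sq :
    (fun N : ℕ => (N : ℝ) ^ (3 / 4 : ℝ) * Real.log N ^ 2) =o[atTop] fun N : ℕ => (N : ℝ) := by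
  have h1 : (fun x : ℝ => Real.log x ^ 2) =o[atTop] fun x : ℝ => x ^ (1 / 4 : ℝ) := by
    have := isLittleO_log_rpow_rpow_atTop (2 : ℝ) (by norm_num : (0 : ℝ) < 1 / 4)
    simpa using this
  have h2 : (fun x : ℝ => x ^ (3 / 4 : ℝ) * Real.log x ^ 2) =o[atTop]
      fun x : ℝ => x ^ (3 / 4 : ℝ) * x ^ (1 / 4 : ℝ) :=
    (isBigO_refl _ _).mul_isLittleO h1
  have h3 : (fun x : ℝ => x ^ (3 / 4 : ℝ) * x ^ (1 / 4 : ℝ)) =ᶠ[atTop] fun x : ℝ => x := by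
    filter_upwards [eventually_ge_atTop (0 : ℝ)] with x hx
    rw [← Real.rpow_add' hx (by norm_num)]
    norm_num
  exact (h2.trans_eventuallyEq h3).comp_tendsto tendsto_natCast_atTop_atTop

/-- **The corrected power saving implies the qualitative statement** `∑_{d ≤ N} S_f(h, d) = o(N)`
for `f = X² − D`. [folklore] -/
theorem hooley1963_quadraticRoots_allModuli_logSqSaving.isLittleO
    (H : hooley1963_quadraticRoots_allModuli_logSqSaving) {D : ℤ} (hD : ¬IsSquare D) {h : ℤ}
    (hh : h ≠ 0) :
    (fun N : ℕ => ∑ d ∈ Finset.Icc 1 N, polyRootWeylSum (X ^ 2 - C D) d h) =o[atTop]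
      fun N : ℕ => (N : ℝ) :=
  (H D hD h hh).trans_isLittleO isLittleO_rpow_three_quarters_mul_log_sq

/-! ### From roots to classes of forms of discriminant `4D` -/

/-- `4D` is a square only if `D` is. [folklore] -/
theorem not_isSquare_four_mul {D : ℤ} (hD : ¬ IsSquare D) : ¬ IsSquare (4 * D) := by
  rintro ⟨k, hk⟩
  have heven : Even k := by
    by_contra hodd
    rw [Int.not_even_iff_odd] at hodd
    have : Odd (k * k) := hodd.mul hodd
    rw [← hk] at this
    exact (Int.not_even_iff_odd.2 this) ⟨2 * D, by ring⟩
  obtain ⟨m, rfl⟩ := heven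
  exact hD ⟨m, by linarith⟩

/-- `discrim 1 0 (−D) = 4D`. [folklore] -/
theorem discrim_one_zero_neg (D : ℤ) : discrim 1 0 (-D) = 4 * D := by
  rw [discrim]; ring

/-- **The Weyl sums over the roots of `X² − D` to all moduli `≤ N` as a sum over the
`T`-reduced forms of discriminant `4D` with `0 < A ≤ N`** (the tree's
`sum_weylSum_eq_sum_levelForms` with `a = 1`, `b = 0`, `c = −D`, `d = 1`).
[cite: DukeFriedlanderIwaniec1995, (13)–(14) p. 428] -/
theorem sum_polyRootWeylSum_sq_sub_eq (D h : ℤ) (N : ℕ) :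
    ∑ d ∈ Finset.Icc 1 N, polyRootWeylSum (X ^ 2 - C D) d h =
      ∑ Q ∈ levelFormsUpTo 1 0 (-D) 1 N, classWeight h Q := by
  have hmain := sum_weylSum_eq_sum_levelForms (a := 1) one_pos 0 (-D) 1 N h (fun _ => 1)
  have hpoly : (C 1 * X ^ 2 + C 0 * X + C (-D) : ℤ[X]) = X ^ 2 - C D := by
    simp only [map_one, one_mul, map_zero, zero_mul, add_zero, map_neg]; ring
  have hfilter : (Finset.Icc 1 N).filter (fun n => 1 ∣ n) = Finset.Icc 1 N :=
    Finset.filter_true_of_mem fun n _ => one_dvd n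
  rw [hpoly, hfilter] at hmain
  simp only [one_mul, Int.cast_zero, sub_zero] at hmain
  rw [hmain]
  rfl

/-- The fibre over a class representative `R`: the `T`-reduced forms `Q` of discriminant `4D` with
`0 < A_Q ≤ N` and `rep Q = R`. [folklore] -/
def classFibre (D : ℤ) (R : BinQF) (N : ℕ) : Finset BinQF :=
  (levelFormsUpTo 1 0 (-D) 1 N).filter (fun Q => rep Q = R)

/-- A form of discriminant `4D` has even middle coefficient. [folklore] -/
theorem even_b_of_disc_eq {Q : BinQF} {D : ℤ} (h : Q.disc = 4 * D) : 2 ∣ Q.b := by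
  rw [BinQF.disc] at h
  by_contra hodd
  have hodd' : Odd Q.b := Int.not_even_iff_odd.1 (fun he => hodd (even_iff_two_dvd.1 he))
  have : Odd (Q.b ^ 2) := hodd'.pow
  rw [show Q.b ^ 2 = 4 * D + 4 * Q.a * Q.c by linarith] at this
  exact (Int.not_even_iff_odd.2 this) ⟨2 * D + 2 * Q.a * Q.c, by ring⟩

/-- **A non-empty fibre is a full class**: if `Q₀ ∈ classFibre D R N₀`, then for every `N` the
fibre over `R` consists exactly of the `T`-reduced forms equivalent to `Q₀` with `0 < A ≤ N`.
[folklore] -/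
theorem mem_classFibre_iff_of_mem {D : ℤ} (hD : ¬ IsSquare D) {R Q₀ : BinQF} {N₀ : ℕ}
    (h₀ : Q₀ ∈ classFibre D R N₀) (N : ℕ) (Q : BinQF) :
    Q ∈ classFibre D R N ↔
      (∃ ξ : SL(2, ℤ), Q = smul Q₀ ξ) ∧ IsTReduced Q ∧ 0 < Q.a ∧ Q.a ≤ N := by
  have h4D : ¬ IsSquare (discrim 1 0 (-D)) := by
    rw [discrim_one_zero_neg]; exact not_isSquare_four_mul hD
  obtain ⟨⟨hL₀, hA₀, -, -⟩, hrep₀⟩ := (mem_fibre_iff (d := 1) (N := N₀) (R := R) one_pos).1 h₀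
  have hdisc₀ : Q₀.disc = discrim 1 0 (-D) := hL₀.disc_eq
  have hΔ₀ : ¬ IsSquare Q₀.disc := by rw [hdisc₀]; exact h4D
  obtain ⟨-, ξ₀, hξ₀⟩ := rep_spec hΔ₀
  rw [hrep₀] at hξ₀
  rw [classFibre, mem_fibre_iff (d := 1) (N := N) (R := R) one_pos]
  constructor
  · rintro ⟨⟨hL, hA, hAN, hT⟩, hrep⟩
    have hΔ : ¬ IsSquare Q.disc := by rw [hL.disc_eq]; exact h4D
    obtain ⟨-, ξ₁, hξ₁⟩ := rep_spec hΔ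
    rw [hrep] at hξ₁
    refine ⟨⟨ξ₀⁻¹ * ξ₁, ?_⟩, hT, hA, by simpa using hAN⟩
    rw [smul_mul, hξ₀, smul_mul_inv, ← hξ₁]
  · rintro ⟨⟨ξ, rfl⟩, hT, hA, hAN⟩
    refine ⟨⟨⟨?_, ?_, ?_⟩, hA, by simpa using hAN, hT⟩, ?_⟩
    · rw [smul_disc, hdisc₀]
    · simp
    · rw [sub_zero]
      simpa using even_b_of_disc_eq (D := D) (Q := smul Q₀ ξ) (by rw [smul_disc, hdisc₀, discrim_one_zero_neg])
    · rw [rep_smul, hrep₀]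

/-- **Hooley's bound, class by class**: for every class representative `R`,
`∑_{Q ∈ classFibre D R N} e(h B_Q/(2A_Q)) = O(N^{3/4}(log N)²)` (`D` not a square, `h ≠ 0`).
[cite: Hooley1963, §6] -/
theorem isBigO_sum_classFibre {D : ℤ} (hD : ¬ IsSquare D) {h : ℤ} (hh : h ≠ 0) (R : BinQF) :
    (fun N : ℕ => ∑ Q ∈ classFibre D R N, classWeight h Q) =O[atTop]
      fun N : ℕ => (N : ℝ) ^ (3 / 4 : ℝ) * Real.log N ^ 2 := by
  by_cases hne : ∃ (N₀ : ℕ) (Q₀ : BinQF), Q₀ ∈ classFibre D R N₀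
  · obtain ⟨N₀, Q₀, h₀⟩ := hne
    have h4D : ¬ IsSquare (discrim 1 0 (-D)) := by
      rw [discrim_one_zero_neg]; exact not_isSquare_four_mul hD
    obtain ⟨⟨hL₀, hA₀, -, -⟩, -⟩ := (mem_fibre_iff (d := 1) (N := N₀) (R := R) one_pos).1 h₀
    have hΔ₀ : ¬ IsSquare Q₀.disc := by rw [hL₀.disc_eq]; exact h4D
    exact Hooley1963.isBigO_sum_class hA₀ hΔ₀ hh (classFibre D R) (mem_classFibre_iff_of_mem hD h₀)
  · push Not at hne
    have hzero : ∀ N, ∑ Q ∈ classFibre D R N, classWeight h Q = 0 := fun N =>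
      Finset.sum_eq_zero fun Q hQ => absurd hQ (hne N Q)
    simp only [hzero]
    exact isBigO_zero _ _

/-! ### The theorem -/

/-- **Hooley's theorem on the roots of a quadratic congruence to all moduli, power-saving form —
PROVED** (discharges the corrected fact `hooley1963_quadraticRoots_allModuli_logSqSaving`):
for `D` not a square and `h ≠ 0`, `∑_{d ≤ N} ∑_{ν² ≡ D (mod d)} e(hν/d) = O(N^{3/4}(log N)²)`
("in particular, `|R(h, x)| ≤ A(h) x^{3/4} log² x`"). [cite: Hooley1963, Theorem 1 (p. 110)] -/
theorem hooley1963_quadraticRoots_allModuli_logSqSaving_holds :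
    hooley1963_quadraticRoots_allModuli_logSqSaving := by
  intro D hD h hh
  have h4D : ¬ IsSquare (discrim 1 0 (-D)) := by
    rw [discrim_one_zero_neg]; exact not_isSquare_four_mul hD
  have heq : ∀ N : ℕ, ∑ d ∈ Finset.Icc 1 N, polyRootWeylSum (X ^ 2 - C D) d h =
      ∑ R ∈ classReps (discrim 1 0 (-D)), ∑ Q ∈ classFibre D R N, classWeight h Q := by
    intro N
    rw [sum_polyRootWeylSum_sq_sub_eq,
      sum_levelFormsUpTo_eq_sum_classReps (d := 1) (N := N) one_pos h4D (classWeight h)]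
    rfl
  simp only [heq]
  exact IsBigO.sum fun R _ => isBigO_sum_classFibre hD hh R

/-- The qualitative statement `∑_{d ≤ N} S_{X²−D}(h, d) = o(N)`, now unconditional. [folklore] -/
theorem isLittleO_sum_polyRootWeylSum_sq_sub {D : ℤ} (hD : ¬ IsSquare D) {h : ℤ} (hh : h ≠ 0) :
    (fun N : ℕ => ∑ d ∈ Finset.Icc 1 N, polyRootWeylSum (X ^ 2 - C D) d h) =o[atTop]
      fun N : ℕ => (N : ℝ) :=
  hooley1963_quadraticRoots_allModuli_logSqSaving_holds.isLittleO hD hh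

end Literature.NumberTheory.Sieve

end
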